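import Summits.ABC.IUTFork.Cor312PilotIdelesCapstone
import HarnessLib

/-!
# [IUTchIII] Cor. 3.12, statement — `^{n,∘}𝒰_{j,∞}` at the ARCHIMEDEAN index of c312-5's `Real.settingDHVol` is the whole
# packet, hence (Ind1),(Ind2)-STABLE for ANY Θ-boxes (the trivial archimedean container)

PROOF-ONLY note (abc-iut cell, Cor. 3.12 sub-crew, seat abc-iut-c312-5, gen 4); TAKES NO SIDE on [IUTchIII] Cor. 3.12;
no definition, no `Prop` fact. The one-set stability hypothesis `hst` of abc-iut-w5-d060's `Cor312HullGluedStable`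
(p424693) is indexed by ALL packets `(i+1, v_ℚ)`, `v_ℚ ∈ V_ℚ = {∞} ⊔ {primes}`. At c312-5's setting of record the
archimedean index carries the TRIVIAL container of `Cor312VolumesRealAssembly` (a MODELLING CHOICE, not Dupuy–Hilado's
Def. 3.6.1; the honest archimedean twin is abc-iut-w5-d163's `Real.settingDHVolArch`, whose hull at `∞` is computed in
`Cor312ThetaLocalDHVolArch`): the field-factor index `factorIdxDH j (inl u)` is EMPTY, so the real frame at `(j, ∞)` has
exactly one hull-set — everything. Hence, for ANY Θ-box binder:

* `frame_hul_eq_univ_settingDHVol_inl` — every hull-set of the frame at `(j, ∞)` is the whole packet;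
* **`thetaHull_settingDHVol_inl`** — `^{n,∘}𝒰_{j,∞} = 𝓘^ℚ(^{S^±_{j+1}};𝒟^⊢_∞)` (the whole packet);
* **`stable_thetaHull_settingDHVol_inl`** — `hst` HOLDS at every archimedean packet (a bijection maps the whole packet
  onto itself).
With `Cor312HullStableDHVol` (odd `p ∤ disc F`, scaled boxes) and p425664 (unit boxes) this leaves `hst` at the setting
of record open exactly at the packets over the primes dividing `2·disc(F)`. [claim: Mochizuki2012, status: disputed]
vocabulary only; [cite: DupuyHilado2025, §4.7, §4.9].
-/

noncomputable section

open Set Function NumberField IsDedekindDomain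

namespace Summit.ABC

namespace IUTFork

namespace Thm311

namespace Real

open Cor312 Cor312Vol Literature.IUT.LogThetaLattice Literature.IUT.LogVolume

variable {F : Type} [Field F] [NumberField F] (X : PilotData F) {logv : PadicLogs F} (hlog : LogvAnalytic logv)

section Setting

variable (M : Type) [Field M] [NumberField M]
  (archPk : ∀ (j : (thetaIndex X).Label) (vQ : (thetaIndex X).VQ), Set ((logShellsDH X logv).Packet j vQ))
  (archSub : ∀ (j : (thetaIndex X).Label) (v : (thetaIndex X).V),
    Set ((logShellsDH X logv).Packet j ((thetaIndex X).over v)))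
  (Ψ : ℤ → ∀ v : (thetaIndex X).V, v ∈ (thetaIndex X).Vbad → Set ((logShellsDH X logv).StarPacket v))
  (act : ℤ → ∀ v : (thetaIndex X).V, v ∈ (thetaIndex X).Vbad →
    (logShellsDH X logv).StarPacket v → Module.End ℚ ((logShellsDH X logv).StarPacket v))
  (Mmod : ℤ → ∀ j : (thetaIndex X).LabelStar, Set ((logShellsDH X logv).GlobalPacket j.1))
  (region : ℤ → ∀ j : (thetaIndex X).LabelStar, FinDivisor M → ∀ vQ : (thetaIndex X).VQ,
    Set ((logShellsDH X logv).Packet j.1 vQ))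
  (n : ℤ) {HT : Type} {LogLink : HT → HT → Type} {IsFull : ∀ {s t : HT}, LogLink s t → Prop}
  (lat : LGPGaussianLogThetaLattice LogLink IsFull)
  {Frd : Type} {IsoF : Frd → Frd → Type} {Ob : Frd → Type} {realify : Frd → Frd} {Strip : Type}
  {IsoS : Strip → Strip → Type} {Mv : ∀ v : (thetaIndex X).V, v ∈ (thetaIndex X).Vbad → Type}
  [∀ v h, Monoid (Mv v h)]
  (sig : GlobalLGPFrobenioidSignature (thetaIndex X).lstar (thetaIndex X).V (· ∈ (thetaIndex X).Vbad)
    Frd IsoF Ob realify Strip IsoS Mv)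
  (split : SplittingMonoids Mv) {ObΔ : Type} {N : ∀ v : (thetaIndex X).V, v ∈ (thetaIndex X).Vbad → Type}
  [∀ v h, Monoid (N v h)] (qData : QPilotData ObΔ N)
  (thetaBox : ℤ → Ob sig.Clgp → ∀ (j : (thetaIndex X).Label) (vQ : (thetaIndex X).VQ),
    Set (∀ s : factorIdxDH X hlog j vQ, factorFieldDH X hlog j vQ s))
  (qCentre : ObΔ → ∀ (j : (thetaIndex X).Label) (vQ : (thetaIndex X).VQ),
    ∀ s : factorIdxDH X hlog j vQ, factorFieldDH X hlog j vQ s)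
  (hq : ∀ j vQ s, qCentre (qPilotObject qData) j vQ s ≠ 0)
  (hfin : ∀ j : (thetaIndex X).Label, (Function.support fun vQ =>
    ((situationDHVol X hlog M archPk archSub Ψ act Mmod region).D n).logvol j vQ
      (factorMapDH X hlog j vQ ⁻¹' hullSet (factorFieldDH X hlog j vQ) (qCentre (qPilotObject qData) j vQ))).Finite)

/-- **Every hull-set of the real frame at `(j, ∞)` is the whole packet** (the hull-sets of a product over the EMPTY
index are `{everything}`, pulled back along the comparison). [folklore] -/
theorem frame_hul_eq_univ_settingDHVol_inl (j : (thetaIndex X).Label) (u : Unit)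
    {H : Set ((logShellsDH X logv).Packet j (.inl u))}
    (hH : H ∈ ((settingDHVol X hlog M archPk archSub Ψ act Mmod region n lat sig split qData thetaBox qCentre hq
      hfin).frame j (.inl u)).Hul) : H = Set.univ := by
  haveI := isEmpty_factorIdxDH_inl X hlog u j
  obtain ⟨H', hH', rfl⟩ := hH
  obtain ⟨c, -, rfl⟩ := hH'
  haveI : IsEmpty ((realPiecesDH X hlog M archPk archSub Ψ act Mmod region thetaBox qCentre).J j (.inl u)) :=
    isEmpty_factorIdxDH_inl X hlog u j
  refine Set.eq_univ_of_forall fun x => ?_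
  rw [Set.mem_preimage, hullSet, mem_polydisc]
  exact fun s => isEmptyElim s

/-- **`^{n,∘}𝒰_{j,∞}` is the whole packet** at c312-5's setting of record, for ANY Θ-boxes. [claim: Mochizuki2012, status: disputed] -/
theorem thetaHull_settingDHVol_inl (j : (thetaIndex X).Label) (u : Unit) :
    (settingDHVol X hlog M archPk archSub Ψ act Mmod region n lat sig split qData thetaBox qCentre hq
      hfin).thetaHull j (.inl u) = Set.univ := by
  unfold Setting.thetaHull HullFrame.hull
  split_ifs with hb
  · refine Set.eq_univ_of_forall fun x => Set.mem_sInter.2 ?_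
    rintro H ⟨hH, -⟩
    rw [frame_hul_eq_univ_settingDHVol_inl X hlog M archPk archSub Ψ act Mmod region n lat sig split qData thetaBox
      qCentre hq hfin j u hH]
    trivial
  · rfl

/-- **ONE-SET STABILITY `hst` at every ARCHIMEDEAN packet of the setting of record, for ANY Θ-boxes** (the hypothesis of
abc-iut-w5-d060's `Cor312HullGluedStable` at `v_ℚ = ∞`). [cite: DupuyHilado2025, §4.7, §4.9] -/
theorem stable_thetaHull_settingDHVol_inl (j : (thetaIndex X).Label) (u : Unit) :
    ∀ Φ ∈ Setting.indGroup (situationDHVol X hlog M archPk archSub Ψ act Mmod region),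
      Φ j (.inl u) ''
          (settingDHVol X hlog M archPk archSub Ψ act Mmod region n lat sig split qData thetaBox qCentre hq
            hfin).thetaHull j (.inl u) =
        (settingDHVol X hlog M archPk archSub Ψ act Mmod region n lat sig split qData thetaBox qCentre hq
          hfin).thetaHull j (.inl u) := by
  intro Φ _
  rw [thetaHull_settingDHVol_inl]
  exact Set.image_univ_of_surjective (Φ j (.inl u)).surjective

end Setting

end Real

end Thm311

end IUTFork

end Summit.ABC

end
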